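import Literature.Computability.Cryptography.MaskedLevels
import Literature.Computability.Cryptography.MaskedPRP
import Literature.Computability.Cryptography.ZhandryOracleProofs
import HarnessLib

/-!
# The Servedio–Gortler / Simon oracle is in `P/poly`: masked levels as raw levels of a mask-extended ensemble

Sibling proof file of `MaskedLevels.lean` (theorems and plumbing only). It proves the `P/poly`
bound for the oracles of well-formed MASKED content assignments,
`maskOracle_mem_PPoly : maskOracle F ℓ C ∈ PPoly` — the hypothesis `MaskPPoly` of the Simon assembly
`Literature/Barriers/QuantumAdvantage/PPolyOraclesThm76Simon.lean` — by REDUCTION to the discharged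
`P/poly` leaf of the Zhandry encoding (`aaronsonChen2017_thm76_memPPoly_holds`,
`ZhandryOracleProofs.lean`; Aaronson–Chen 2017, proof of Thm. 7.6, last sentence: "each `f_n` has
a polynomial-size circuit, and consequently `O ∈ P/poly`"):

* the **mask-extended ensemble** `maskEnsemble F`: under the key `⟨k, b·t⟩` it computes `F n k x`
  if `b = 0` and `F n k (rep_{1·t} x)` if `b = 1` (through the positionwise translation `transQ t`
  of `MaskedPRP.lean`, which is `rep_{1·t}` on the block `{0,1}^{|t|+1}`, `transQ_eq_repStr`),
  normalised to be length-preserving on every key; it is an efficiently computable family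
  (`isEfficientFamily_maskEnsemble`: one `FP` string brick `maskEnsFn` from `strFn F`,
  `xorPadFn`, pair projections and `iteFn`, and `PolyTimeComputable.of_encode`);
* the **content translation** `toZhandry`: `filler ↦ filler`, `prp k ↦ prp ⟨k, 0·0^{ℓ n − 1}⟩`,
  `masked k t ↦ prp ⟨k, 1·t⟩`, preserving well-formedness (key length `2 κ n + 2 + ℓ n`, `maskKeyLen`)
  and the level blocks (`strings_toZhandry`), whence `maskOracle F ℓ C = zhandryOracle (maskEnsemble F) ℓ (toZhandry ∘ C)`
  (`maskOracle_eq_zhandryOracle`) and the bound.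

## References

* [AaronsonChen2017] arXiv:1612.05903, Thm. 7.6 (proof, last sentence, p. 30).
* [ServedioGortler2004] SIAM J. Comput. 33 (2004), §8.1 (the masked pseudorandom functions have
  polynomial-size circuits: "it is straightforward to output a circuit").
* [AroraBarak2009] Def. 6.5, Thm. 6.18, §1.3.
-/

noncomputable section

namespace Literature.Computability.Cryptography

open _root_.Computability Complexity Complexity.Brick Complexity.HashBricks Complexity.PRelSigma
open Literature.Computability.Cryptography.LubyRackoff (strFn strFn_boolPair strFn_mem_FP)

variable {F : FunctionEnsemble} {κ ℓ : ℕ → ℕ}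

/-! ### The mask-extended ensemble -/

/-- **The mask-extended ensemble**: key `⟨k, r⟩`; if `r` starts with `1`, the argument is first
translated by `transQ r.tail` (`= rep_{1·r.tail}` on the block `{0,1}^{|r|}`), then `F n k` is
applied; the value is kept only if it has the length of the argument (so the family is
length-preserving on every key). [cite: ServedioGortler2004, §8.1] -/
def maskEnsemble (F : FunctionEnsemble) : FunctionEnsemble := fun n key x =>
  let v := if (boolUnpair key).2.headD false then F n (boolUnpair key).1 (transQ (boolUnpair key).2.tail x)
    else F n (boolUnpair key).1 x
  if v.length = x.length then v else x

/-- The key length of the mask-extended ensemble: `|⟨k, b·t⟩| = 2 κ n + 2 + (1 + (ℓ n − 1))`. [folklore] -/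
def maskKeyLen (κ ℓ : ℕ → ℕ) (n : ℕ) : ℕ := 2 * κ n + 2 + (1 + (ℓ n - 1))

/-- Under a `PRP^raw` key `⟨k, 0·u⟩` the extended ensemble is `F n k` on arguments where `F n k` is
length-preserving. [folklore] -/
theorem maskEnsemble_false (hF : IsEfficientFamily F κ ℓ ℓ) {n : ℕ} {k : List Bool} (hk : k.length = κ n)
    (u x : List Bool) (hx : x.length = ℓ n) :
    maskEnsemble F n (boolPair k (false :: u)) x = F n k x := by
  have hl : (F n k x).length = x.length := by rw [hF.2.2 n k x hk hx, hx]
  simp [maskEnsemble, hl]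

/-- Under a masked key `⟨k, 1·t⟩` with `|t| + 1 = ℓ n` the extended ensemble is `F n k ∘ rep_{1·t}`
on the block. [cite: ServedioGortler2004, §8.1] -/
theorem maskEnsemble_true (hF : IsEfficientFamily F κ ℓ ℓ) {n : ℕ} {k t : List Bool} (hk : k.length = κ n)
    (ht : t.length + 1 = ℓ n) (x : List Bool) (hx : x.length = ℓ n) :
    maskEnsemble F n (boolPair k (true :: t)) x = F n k (repStr (true :: t) x) := by
  have htr : transQ t x = repStr (true :: t) x := by
    rw [transQ_eq_repStr hx (by omega), show ℓ n - 1 = t.length by omega, List.take_length]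
  have hl : (F n k (repStr (true :: t) x)).length = x.length := by
    rw [hF.2.2 n k _ hk (by rw [length_repStr, hx]), hx]
  simp [maskEnsemble, htr, hl]

/-- The extended ensemble is length-preserving on every key. [folklore] -/
theorem length_maskEnsemble (n : ℕ) (key x : List Bool) : (maskEnsemble F n key x).length = x.length := by
  simp only [maskEnsemble]
  split_ifs with h1 h2 h2 <;> first | exact h2 | rfl

/-! ### The extended ensemble is efficiently computable (one string brick) -/

section Brick

/-- `x` (input `⟨u, ⟨key, x⟩⟩`). [folklore] -/
def meX : List Bool → List Bool := sndF ∘ sndF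
/-- `k`, the first key field. [folklore] -/
def meK : List Bool → List Bool := fstF ∘ fstF ∘ sndF
/-- `r = b·t`, the second key field. [folklore] -/
def meR : List Bool → List Bool := sndF ∘ fstF ∘ sndF
/-- The translated argument `transQ r.tail x`. [folklore] -/
def meTrans : List Bool → List Bool :=
  iteFn (headBitFn ∘ meX) (xorPadFn ∘ fanoutFn meX (List.cons true ∘ List.tail ∘ meR)) meX
/-- The value before normalisation: `F |u| k x` or `F |u| k (transQ r.tail x)` by the head bit of `r`. [folklore] -/
def meVal (F : FunctionEnsemble) : List Bool → List Bool :=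
  iteFn (headBitFn ∘ meR) (strFn F ∘ fanoutFn fstF (fanoutFn meK meTrans))
    (strFn F ∘ fanoutFn fstF (fanoutFn meK meX))
/-- `[|value| = |x|]`. [folklore] -/
def meLenOk (F : FunctionEnsemble) : List Bool → List Bool :=
  eqPairFn ∘ fanoutFn (onesFn ∘ meVal F) (onesFn ∘ meX)
/-- **The string brick of the extended ensemble.** [folklore] -/
def maskEnsFn (F : FunctionEnsemble) : List Bool → List Bool :=
  iteFn (meLenOk F) (meVal F) meX

/-- Value of the translation brick. [folklore] -/
theorem meTrans_apply (u key x : List Bool) :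
    meTrans (boolPair u (boolPair key x)) = transQ (boolUnpair key).2.tail x := by
  have hc : (headBitFn ∘ meX) (boolPair u (boolPair key x)) = [x.headD false] := by simp [meX]
  rw [meTrans, iteFn_apply hc, transQ]
  cases x.headD false
  · simp [meX]
  · simp only [if_true, Function.comp_apply, fanoutFn_apply]
    rw [show meX (boolPair u (boolPair key x)) = x by simp [meX],
      show meR (boolPair u (boolPair key x)) = (boolUnpair key).2 by simp [meR, sndF, fstF]]
    exact xorPadFn_boolPair x _

/-- Value of the pre-normalisation brick. [folklore] -/
theorem meVal_apply (n : ℕ) (key x : List Bool) :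
    meVal F (boolPair (unaryEncodeNat n) (boolPair key x)) =
      (if (boolUnpair key).2.headD false then F n (boolUnpair key).1 (transQ (boolUnpair key).2.tail x)
        else F n (boolUnpair key).1 x) := by
  have hR : meR (boolPair (unaryEncodeNat n) (boolPair key x)) = (boolUnpair key).2 := by
    simp [meR, sndF, fstF]
  have hK : meK (boolPair (unaryEncodeNat n) (boolPair key x)) = (boolUnpair key).1 := by
    simp [meK, sndF, fstF]
  have hX : meX (boolPair (unaryEncodeNat n) (boolPair key x)) = x := by simp [meX]
  have hc : (headBitFn ∘ meR) (boolPair (unaryEncodeNat n) (boolPair key x)) =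
      [(boolUnpair key).2.headD false] := by
    rw [Function.comp_apply, hR, headBitFn_apply]
  have hn : (unaryEncodeNat n).length = n := unary_decode_encode_nat n
  rw [meVal, iteFn_apply hc]
  split_ifs with h
  · simp only [Function.comp_apply, fanoutFn_apply, fstF_boolPair, hK, meTrans_apply, strFn_boolPair, hn]
  · simp only [Function.comp_apply, fanoutFn_apply, fstF_boolPair, hK, hX, strFn_boolPair, hn]

/-- **Value of the brick: the extended ensemble.** [folklore] -/
theorem maskEnsFn_apply (n : ℕ) (key x : List Bool) :
    maskEnsFn F (boolPair (unaryEncodeNat n) (boolPair key x)) = maskEnsemble F n key x := by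
  have hX : meX (boolPair (unaryEncodeNat n) (boolPair key x)) = x := by simp [meX]
  have hV := meVal_apply (F := F) n key x
  have hc : meLenOk F (boolPair (unaryEncodeNat n) (boolPair key x)) =
      [decide ((meVal F (boolPair (unaryEncodeNat n) (boolPair key x))).length = x.length)] := by
    rw [meLenOk, Function.comp_apply, fanoutFn_apply, Function.comp_apply, Function.comp_apply, hX,
      eqPairFn_boolPair]
    simp [onesFn, OracleCompose.unaryEncodeNat_eq_replicate]
  rw [maskEnsFn, iteFn_apply hc, hX, hV, maskEnsemble]
  simp only [decide_eq_true_eq]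

/-- The brick is in `FP`. [cite: AroraBarak2009, §1.3] -/
theorem maskEnsFn_mem_FP (hF : IsEfficientFamily F κ ℓ ℓ) : maskEnsFn F ∈ FP := by
  have hX : meX ∈ FP := comp_mem_FP sndF_mem_FP sndF_mem_FP
  have hK : meK ∈ FP := comp_mem_FP fstF_mem_FP (comp_mem_FP fstF_mem_FP sndF_mem_FP)
  have hR : meR ∈ FP := comp_mem_FP sndF_mem_FP (comp_mem_FP fstF_mem_FP sndF_mem_FP)
  have hT : meTrans ∈ FP :=
    iteFn_mem_FP (comp_mem_FP headBitFn_mem_FP hX)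
      (comp_mem_FP xorPadFn_mem_FP (fanoutFn_mem_FP hX
        (comp_mem_FP (cons_mem_FP true) (comp_mem_FP tail_mem_FP hR)))) hX
  have hV : meVal F ∈ FP :=
    iteFn_mem_FP (comp_mem_FP headBitFn_mem_FP hR)
      (comp_mem_FP (strFn_mem_FP hF.1) (fanoutFn_mem_FP fstF_mem_FP (fanoutFn_mem_FP hK hT)))
      (comp_mem_FP (strFn_mem_FP hF.1) (fanoutFn_mem_FP fstF_mem_FP (fanoutFn_mem_FP hK hX)))
  have hL : meLenOk F ∈ FP :=
    comp_mem_FP eqPairFn_mem_FP (fanoutFn_mem_FP (comp_mem_FP onesFn_mem_FP hV) (comp_mem_FP onesFn_mem_FP hX))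
  exact iteFn_mem_FP hL hV hX

end Brick

/-- **The mask-extended ensemble is efficiently computable** (key length `maskKeyLen κ ℓ`, block
length `ℓ`). [cite: ServedioGortler2004, §8.1] [cite: AroraBarak2009, §1.3] -/
theorem isEfficientFamily_maskEnsemble (hF : IsEfficientFamily F κ ℓ ℓ) :
    IsEfficientFamily (maskEnsemble F) (maskKeyLen κ ℓ) ℓ ℓ := by
  refine ⟨?_, ?_, fun n k x _ hx => by rw [length_maskEnsemble, hx]⟩
  · exact PolyTimeComputable.of_encode (maskEnsFn_mem_FP hF)
      (fun p : ℕ × List Bool × List Bool => boolPair (unaryEncodeNat p.1) (boolPair p.2.1 p.2.2))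
      (fun _ => rfl) (fun p => maskEnsFn_apply p.1 p.2.1 p.2.2)
  · obtain ⟨q, hq⟩ := hF.2.1
    refine ⟨2 * q + 3 + q, fun n => ?_⟩
    have h1 := (hq n).1
    have h2 := (hq n).2.1
    simp only [maskKeyLen, Polynomial.eval_add, Polynomial.eval_mul, Polynomial.eval_ofNat]
    omega

/-! ### The content translation -/

/-- **Masked contents as raw contents of the extended ensemble.** [folklore] -/
def toZhandry (ℓ : ℕ → ℕ) (n : ℕ) : MaskContent → LevelContent
  | .filler => .filler
  | .prp k => .prp (boolPair k (false :: List.replicate (ℓ n - 1) false))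
  | .masked k t => .prp (boolPair k (true :: t))

/-- Well-formedness is preserved (key length `maskKeyLen`). [folklore] -/
theorem wellFormed_toZhandry {n : ℕ} {c : MaskContent} (hc : c.WellFormed κ ℓ n) :
    (toZhandry ℓ n c).WellFormed (maskKeyLen κ ℓ) ℓ n := by
  cases c with
  | filler => trivial
  | prp k =>
    have hk : k.length = κ n := hc
    show (boolPair k (false :: List.replicate (ℓ n - 1) false)).length = maskKeyLen κ ℓ n
    simp only [length_boolPair, List.length_cons, List.length_replicate, maskKeyLen, hk]
    omega
  | masked k t =>
    obtain ⟨hk, ht⟩ := hc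
    show (boolPair k (true :: t)).length = maskKeyLen κ ℓ n
    simp only [length_boolPair, List.length_cons, maskKeyLen, hk]
    omega

/-- **The level blocks agree**: the block of a masked content is the block of its translation in
the extended ensemble (the level functions agree on the block `{0,1}^{ℓ n}`, which is all
`levelStrings` reads). [folklore] -/
theorem strings_toZhandry (hF : IsEfficientFamily F κ ℓ ℓ) {n : ℕ} {c : MaskContent} (hc : c.WellFormed κ ℓ n) :
    (toZhandry ℓ n c).strings (maskEnsemble F) ℓ n = c.strings F ℓ n := by
  cases c with
  | filler => rfl
  | prp k =>
    have hk : k.length = κ n := hc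
    show levelStrings n (ℓ n) (maskEnsemble F n (boolPair k (false :: List.replicate (ℓ n - 1) false))) =
      levelStrings n (ℓ n) (F n k)
    exact levelStrings_congr fun x hx => maskEnsemble_false hF hk _ x hx
  | masked k t =>
    obtain ⟨hk, ht⟩ := hc
    show levelStrings n (ℓ n) (maskEnsemble F n (boolPair k (true :: t))) =
      levelStrings n (ℓ n) (F n k ∘ repStr (true :: t))
    exact levelStrings_congr fun x hx => maskEnsemble_true hF hk ht x hx

/-- **The masked oracle is a Zhandry oracle of the extended ensemble.** [folklore] -/
theorem maskOracle_eq_zhandryOracle (hF : IsEfficientFamily F κ ℓ ℓ) {C : ℕ → MaskContent}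
    (hC : ∀ n, (C n).WellFormed κ ℓ n) :
    maskOracle F ℓ C = zhandryOracle (maskEnsemble F) ℓ (fun n => toZhandry ℓ n (C n)) := by
  ext w
  rw [mem_maskOracle_iff, mem_zhandryOracle_iff]
  refine exists_congr fun n => ?_
  rw [strings_toZhandry hF (hC n)]

/-- **The oracle of a well-formed masked content assignment is in `P/poly`** ("each `f_n` has a
polynomial-size circuit, and consequently `O ∈ P/poly`", for the Servedio–Gortler levels), by the
discharged `P/poly` leaf of the Zhandry encoding applied to the mask-extended ensemble.
[cite: AaronsonChen2017, Thm. 7.6 (proof, last sentence, p. 30)] [cite: ServedioGortler2004, §8.1] -/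
theorem maskOracle_mem_PPoly (hF : IsEfficientFamily F κ ℓ ℓ) {C : ℕ → MaskContent}
    (hC : ∀ n, (C n).WellFormed κ ℓ n) : maskOracle F ℓ C ∈ PPoly := by
  rw [maskOracle_eq_zhandryOracle hF hC]
  exact aaronsonChen2017_thm76_memPPoly_holds (maskEnsemble F) (maskKeyLen κ ℓ) ℓ
    (isEfficientFamily_maskEnsemble hF) _ fun n => wellFormed_toZhandry (hC n)

end Literature.Computability.Cryptography

end
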